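import Literature.Geometry.Lorentzian.AdiabaticTracking
import Literature.Geometry.Lorentzian.CausalityPushUp
import Summits.FinalStateConjecture.FinalStateConjecture.Theorems.RenormalisedDriftDriftCaptureStubSharpTrackingChain
import HarnessLib

/-!
# GLUING stub `stub_glueSharpChain` of crux `DriftCapture` (stmt-FinalStateConjecture-17391),
# line `registered`: the causal-geometric part (G2) that IS formal — tails pin the same exterior

The registered stub `stub_glueSharpChain` (ASSEMBLE's gluing on `0 < N`, `m₀ ≤ 1`: ONE sharpening
chain `n ↦ cₙ` of `εₙ`-approximate `N`-Kerr configurations on the chart-time windows `[0, 1]`,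
chained, exhausting, with `O = J⁺(ι X) ∩ I⁻(⋃ₙ windows)` pinned and covered, eventually pinned at
`(M, a, Λ)`, ⇒ `N + 1` late charts with the twelve floor-free packaging clauses of
`decomposition_of_unflooredLateCharts`) has three ingredients: (G1) near-isometry rigidity of the
window charts on consecutive seams, (G2) the causal geometry of the window images along the chain,
(G3) the patching. This file lands the part of (G2) which follows from the clause list ALONE — from
the causal trichotomy `O ⊆ windowImage ∪ J⁻(slab τ) ∪ J⁺(slab (τ + L))` of every configuration
(`ApproximateKerrConfiguration.subset_windowImage_union`) and from exhaustion (the window images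
leave `J⁻(K)` for every compact `K`); chaining, pinning, covering, labels and accuracies are not used:

* `eventually_below_startSlab` — **every point of `O` lies, for all sufficiently late windows, OUTSIDE
  the window and in the causal past of its START slab** (`K = {p}`: a late window meets neither `p`
  nor a point causally before `p`, so of the three alternatives only `J⁻(start slab)` survives);
* `chronologicalPast_iUnion_windowImage_tail` / `exteriorOf_iUnion_windowImage_tail` — consequently
  EVERY TAIL OF THE CHAIN DETERMINES THE SAME EXTERIOR:
  `J⁺(ι X) ∩ I⁻(⋃ₙ windowImage c_{n₀+n}) = J⁺(ι X) ∩ I⁻(⋃ₙ windowImage cₙ)` for all `n₀` (a point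
  `p ≪ q` with `q` in some window has `q ≤ r` for `r` on the start slab of any sufficiently late
  window, and `p ≪ q ≤ r ⇒ p ≪ r` is push-up, O'Neill 1983, Ch. 14, Cor. 14.1, on the manifold
  without boundary `𝒟`);
* `isAdiabaticallyTracked_of_sharpChain_of_covered` — so the first of the two "restart identities"
  taken as hypotheses by the landed `isAdiabaticallyTracked_of_sharpChain_of_restart` (p-landed file
  `RenormalisedDriftDriftCaptureStubSharpTrackingChain.lean`) is a theorem: a sharpening chain whose
  tails are merely COVERED is a tracking at every accuracy.

Why the gluing needs it (its use in the lead's reduction `stub_glueSharpChain_of_missing`): the glued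
late charts are built from the windows `n ≥ n₀` only (early windows have accuracy `εₙ = ⊤`), their
charted late region `U'` satisfies `⋃ₙ windowImage c_{n₀+n} ⊆ U' ⊆ O`, and the stub's self-determined
region `O' := J⁺(ι X) ∩ I⁻(U')` must be identified with the chain's `O` before the covering clause of
the windows can serve the covering clause of the charts: `O ⊆ O'` is exactly the tail identity, and
`O' ⊆ O` is `I⁻ ∘ I⁻ ⊆ I⁻`.

No definitions, no named facts, no `sorry`.

References: B. O'Neill, *Semi-Riemannian geometry*, Academic Press 1983, Ch. 14, p. 402 (Cor. 14.1,
push-up) and p. 403 (`J⁻` reflexive, `I⁻`, `J⁻` monotone); S. Klainerman, C. R. Mécanique 353 (2025),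
§1.1.1 (windows of the final-state picture); M. Dafermos, J. Luk, arXiv:1710.01722, Conjecture 1 (the
exterior `J⁻(𝓘⁺) ∩ J⁺(Σ)`).
-/

-- the doubled `FinalStateConjecture.FinalStateConjecture` path component trips dupNamespace
set_option linter.dupNamespace false

noncomputable section

namespace Summit.FinalStateConjecture.FinalStateConjecture.Theorems.RenormalisedDrift.DriftCapture

open Set Filter Topology
open scoped Manifold ContDiff ENNReal
open Literature.Geometry.Lorentzian

universe u

section Spacetime

variable {𝓢 : Spacetime.{u} 4} {O : Set 𝓢.carrier} {k : ℕ} {τ L : ℝ} {ε : ℕ → ℝ≥0∞}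
  {R : ℕ → ℝ}

/-- A point of `J⁺(S)` is reached from a point of `S` lying in its causal past (time duality of the
causal relation between points, with the witness kept in `S`). O'Neill 1983, Ch. 14, p. 402.
[cite: ONeill1983, Ch. 14 p. 402] -/
theorem exists_mem_causalPast_singleton_of_mem_causalFuture {S : Set 𝓢.carrier} {p : 𝓢.carrier}
    (h : p ∈ 𝓢.metric.causalFuture 𝓢.timeOrientation S) :
    ∃ q ∈ S, q ∈ 𝓢.metric.causalPast 𝓢.timeOrientation {p} := by
  rcases h with h | ⟨q, hq, γ, a, b, hab, hγ, hγa, hγb⟩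
  · exact ⟨p, h, LorentzianMetric.subset_causalPast _ _ _ (mem_singleton p)⟩
  · refine ⟨q, hq, Or.inr ⟨p, mem_singleton p, fun t ↦ γ (a + b - t), a, b, hab, hγ.reverseParam,
      ?_, ?_⟩⟩
    · simp [hγb]
    · simp [hγa]

/-- **Every point of `O` is eventually outside the windows and below their start slabs.** In any
spacetime, let `n ↦ cₙ` be configurations of ONE region `O` on the chart-time windows `[τ, τ + L]`
(`0 ≤ L`) of their own charts whose certified window images leave the causal past of every compact
set. Then for every `p ∈ O` and all sufficiently large `n`: `p ∈ J⁻(certifiedSlab cₙ τ)` and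
`p ∉ windowImage cₙ`. Proof: exhaustion at `K = {p}` makes `windowImage cₙ` disjoint from `J⁻(p)`;
since `p ∈ J⁻(p)` and the end slab at `τ + L` lies in the window image, the alternatives
`p ∈ windowImage cₙ` and `p ∈ J⁺(slab (τ + L))` of the causal trichotomy
(`ApproximateKerrConfiguration.subset_windowImage_union`) are excluded. O'Neill 1983, Ch. 14,
pp. 402–403; Klainerman, C. R. Mécanique 353 (2025), §1.1.1. [folklore] -/
theorem eventually_below_startSlab
    (c : ∀ n : ℕ, ApproximateKerrConfiguration 𝓢 O k (ε n) τ L (R n)) (hL : 0 ≤ L)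
    (hex : ∀ K : Set 𝓢.carrier, IsCompact K → ∃ n₀ : ℕ, ∀ n, n₀ ≤ n →
      Disjoint (c n).windowImage (𝓢.metric.causalPast 𝓢.timeOrientation K))
    {p : 𝓢.carrier} (hp : p ∈ O) :
    ∀ᶠ n in atTop, p ∈ 𝓢.metric.causalPast 𝓢.timeOrientation ((c n).certifiedSlab τ) ∧
      p ∉ (c n).windowImage := by
  obtain ⟨n₀, hn₀⟩ := hex {p} isCompact_singleton
  refine eventually_atTop.2 ⟨n₀, fun n hn ↦ ?_⟩
  have hdisj := hn₀ n hn
  have hpp : p ∈ 𝓢.metric.causalPast 𝓢.timeOrientation {p} :=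
    LorentzianMetric.subset_causalPast _ _ _ (mem_singleton p)
  have hnot : p ∉ (c n).windowImage := fun h ↦ Set.disjoint_left.1 hdisj h hpp
  refine ⟨?_, hnot⟩
  rcases (c n).subset_windowImage_union hp with h | h | h
  · exact (hnot h).elim
  · exact h
  · -- `p ∈ J⁺(slab (τ + L))`: a point of the end slab, hence of the window image, lies in `J⁻(p)`
    obtain ⟨q, hq, hqp⟩ := exists_mem_causalPast_singleton_of_mem_causalFuture h
    have hτL : τ + L ∈ Icc τ (τ + L) := ⟨le_add_of_nonneg_right hL, le_rfl⟩
    exact (Set.disjoint_left.1 hdisj ((c n).certifiedSlab_subset_windowImage hτL hq) hqp).elim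

/-- **Every tail of the chain has the same chronological past.** Under the hypotheses of
`eventually_below_startSlab`: `I⁻(⋃ₙ windowImage cₙ) = I⁻(⋃ₙ windowImage c_{n₀+n})` for every `n₀`.
If `p ≪ q` with `q ∈ windowImage cₘ ⊆ O`, then `q ≤ r` for some `r` on the start slab of the window
`n₀ + n₁`, `n₁` large (`eventually_below_startSlab` at `q`), that slab lies in its window image, and
`p ≪ q ≤ r ⇒ p ≪ r` is push-up (O'Neill 1983, Ch. 14, Cor. 14.1, time-dually; the carrier of a
spacetime has no boundary). [cite: ONeill1983, Ch. 14 Cor. 14.1 (p. 402)] -/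
theorem chronologicalPast_iUnion_windowImage_tail
    (c : ∀ n : ℕ, ApproximateKerrConfiguration 𝓢 O k (ε n) τ L (R n)) (hL : 0 ≤ L)
    (hex : ∀ K : Set 𝓢.carrier, IsCompact K → ∃ n₀ : ℕ, ∀ n, n₀ ≤ n →
      Disjoint (c n).windowImage (𝓢.metric.causalPast 𝓢.timeOrientation K)) (n₀ : ℕ) :
    𝓢.metric.chronologicalPast 𝓢.timeOrientation (⋃ n, (c n).windowImage) =
      𝓢.metric.chronologicalPast 𝓢.timeOrientation (⋃ n, (c (n₀ + n)).windowImage) := by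
  refine Subset.antisymm ?_ (LorentzianMetric.chronologicalFuture_mono
    (iUnion_subset fun n ↦ subset_iUnion (fun m ↦ (c m).windowImage) (n₀ + n)))
  intro p hp
  have hn1 : (1 : WithTop ℕ∞) ≤ ((⊤ : ℕ∞) : WithTop ℕ∞) := WithTop.coe_le_coe.mpr le_top
  -- `p ≪ q`, `q` in some window, hence in `O`
  have hp' : p ∈ 𝓢.metric.chronologicalFuture 𝓢.timeOrientation.reverse (⋃ n, (c n).windowImage) :=
    hp
  rw [LorentzianMetric.chronologicalFuture_eq_biUnion] at hp'
  simp only [mem_iUnion, exists_prop] at hp'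
  obtain ⟨q, ⟨m, hqm⟩, hpq⟩ := hp'
  have hqO : q ∈ O := (c m).windowImage_subset hqm
  -- `q ≤ r` with `r` on the start slab of a late window of the tail
  obtain ⟨n₁, hn₁⟩ := eventually_atTop.1 (eventually_below_startSlab c hL hex hqO)
  obtain ⟨hq, -⟩ := hn₁ (n₀ + n₁) (Nat.le_add_left n₁ n₀)
  have hq' : q ∈ 𝓢.metric.causalFuture 𝓢.timeOrientation.reverse
      ((c (n₀ + n₁)).certifiedSlab τ) := hq
  rw [LorentzianMetric.causalFuture_eq_biUnion] at hq'
  simp only [mem_iUnion, exists_prop] at hq'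
  obtain ⟨r, hr, hqr⟩ := hq'
  -- push-up for the reversed time orientation: `p ≪ q ≤ r ⇒ p ≪ r`
  have hpr : p ∈ 𝓢.metric.chronologicalFuture 𝓢.timeOrientation.reverse {r} :=
    LorentzianMetric.mem_chronologicalFuture_of_mem_causalFuture hn1 hqr hpq
  have hτ : τ ∈ Icc τ (τ + L) := ⟨le_rfl, le_add_of_nonneg_right hL⟩
  have hrW : r ∈ ⋃ n, (c (n₀ + n)).windowImage :=
    mem_iUnion.2 ⟨n₁, (c (n₀ + n₁)).certifiedSlab_subset_windowImage hτ hr⟩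
  show p ∈ 𝓢.metric.chronologicalFuture 𝓢.timeOrientation.reverse (⋃ n, (c (n₀ + n)).windowImage)
  rw [LorentzianMetric.chronologicalFuture_eq_biUnion]
  simp only [mem_iUnion, exists_prop]
  exact ⟨r, mem_iUnion.1 hrW, hpr⟩

end Spacetime

section Development

variable {X : Type} [TopologicalSpace X] [ChartedSpace E3 X] [IsManifold (𝓡 3) ∞ X]
  [ConnectedSpace X] {D : InitialDataSet (𝓡 3) X}

/-- **Tails pin the same exterior (the first restart identity).** For configurations `n ↦ cₙ` of
one region `O` of a Cauchy development `𝒟` on the windows `[τ, τ + L]` (`0 ≤ L`) of their own charts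
whose window images leave every compact past:
`exteriorOf 𝒟 (⋃ₙ windowImage c_{n₀+n}) = exteriorOf 𝒟 (⋃ₙ windowImage cₙ)` for every `n₀` —
`J⁺(ι X) ∩ I⁻(·)` of a tail is that of the whole chain (`chronologicalPast_iUnion_windowImage_tail`).
In particular, if `O` is pinned by the chain it is pinned by every tail. Dafermos–Luk
arXiv:1710.01722, Conjecture 1 (the exterior region); O'Neill 1983, Ch. 14, Cor. 14.1. [folklore] -/
theorem exteriorOf_iUnion_windowImage_tail : ∀ {X : Type} [TopologicalSpace X] [ChartedSpace E3 X] [IsManifold (𝓡 3) ((⊤ : ℕ∞) : WithTop ℕ∞) X] [ConnectedSpace X] {D : InitialDataSet (𝓡 3) X} (𝒟 : CauchyDevelopment D) {O : Set 𝒟.carrier} {k : ℕ} {τ L : ℝ} {ε : ℕ → ENNReal} {R : ℕ → ℝ} (c : ∀ n : ℕ, ApproximateKerrConfiguration 𝒟.toSpacetime O k (ε n) τ L (R n)), 0 ≤ L → (∀ K : Set 𝒟.carrier, IsCompact K → ∃ n₀ : ℕ, ∀ n, n₀ ≤ n → Disjoint (c n).windowImage (𝒟.metric.causalPast 𝒟.timeOrientation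 K)) → ∀ n₀ : ℕ, 𝒟.exteriorOf (⋃ n, (c (n₀ + n)).windowImage) = 𝒟.exteriorOf (⋃ n, (c n).windowImage) := by
  intro X _ _ _ _ D 𝒟 O k τ L ε R c hL hex n₀
  unfold CauchyDevelopment.exteriorOf
  rw [chronologicalPast_iUnion_windowImage_tail c hL hex n₀]

/-- **A sharpening chain whose tails are COVERED is a tracking at every accuracy** — the landed
`isAdiabaticallyTracked_of_sharpChain_of_restart` with its first restart hypothesis (tails pin `O`)
discharged by `exteriorOf_iUnion_windowImage_tail`: for any vacuum Cauchy development `𝒟`, complexity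
`(N, m₀, χ)` and window length `L ≥ 0`, a chain `n ↦ cₙ` of `εₙ`-approximate `N`-Kerr configurations
of one region `O` in `C²` on the windows `[0, L]` with `εₙ → 0`, `Rₙ → ∞`, `N` holes in the box,
chained start slabs, exhaustion and `O = J⁺(ι X) ∩ I⁻(⋃ₙ windows)`, such that every tail still
COVERS `O` (`O ⊆ J⁻(slab₀(c_{n₀})) ∪ ⋃ₙ windowImage c_{n₀+n}` for all `n₀`), witnesses
`𝒟.IsAdiabaticallyTracked N m₀ χ ε₀ L R₀` for every `ε₀ > 0` and every `R₀`.
Klainerman, C. R. Mécanique 353 (2025), §2.3; DHRT arXiv:2104.08222, §1. [folklore] -/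
theorem isAdiabaticallyTracked_of_sharpChain_of_covered (𝒟 : VacuumCauchyDevelopment D) (N : ℕ)
    (m₀ χ L : ℝ) (hL : 0 ≤ L) (ε : ℕ → ℝ≥0∞) (R : ℕ → ℝ) (O : Set 𝒟.carrier)
    (c : ∀ n : ℕ, ApproximateKerrConfiguration 𝒟.toSpacetime O 2 (ε n) 0 L (R n))
    (hε : Tendsto ε atTop (𝓝 0)) (hRt : Tendsto R atTop atTop) (hN : ∀ n, (c n).N = N)
    (hM : ∀ n (i : Fin (c n).N), m₀ ≤ (c n).mass i ∧ (c n).mass i ≤ m₀⁻¹ ∧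
      |(c n).spin i| ≤ χ * (c n).mass i)
    (hch : ∀ n, (c (n + 1)).certifiedSlab 0 ⊆ (c n).windowImage)
    (hex : ∀ K : Set 𝒟.carrier, IsCompact K → ∃ n₀ : ℕ, ∀ n, n₀ ≤ n →
      Disjoint (c n).windowImage (𝒟.metric.causalPast 𝒟.timeOrientation K))
    (hpin : O = 𝒟.toCauchyDevelopment.exteriorOf (⋃ n, (c n).windowImage))
    (hcov : ∀ n₀ : ℕ, O ⊆ 𝒟.metric.causalPast 𝒟.timeOrientation ((c n₀).certifiedSlab 0) ∪
      ⋃ n, (c (n₀ + n)).windowImage)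
    (ε₀ : ℝ≥0∞) (R₀ : ℝ) (hε₀ : 0 < ε₀) : 𝒟.IsAdiabaticallyTracked N m₀ χ ε₀ L R₀ :=
  isAdiabaticallyTracked_of_sharpChain_of_restart 𝒟 N m₀ χ L ε R O c hε hRt hN hM hch hex
    (fun n₀ ↦ hpin.trans
      (exteriorOf_iUnion_windowImage_tail 𝒟.toCauchyDevelopment c hL hex n₀).symm)
    hcov ε₀ R₀ hε₀

end Development

end Summit.FinalStateConjecture.FinalStateConjecture.Theorems.RenormalisedDrift.DriftCapture

end
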